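import Summits.ValiantsHypothesis.ValiantsHypothesis.Theorems.GrenetZeonDualUnipotentThreeHalvesLongMassLedgerIndexShadow

/-!
# `GrenetZeon.DualUnipotentThreeHalves` (stmt-ValiantsHypothesis-24318), stub (c) `SlowCore.LongMassSlowLawInv`:
# the index shadow INSIDE THE VALUE SPACE — an intrinsic necessary condition on the nilpotent space of linear parts

✓ `LedgerIndex.linMat_pow_eq_zero_of_ledger` (p828785) says that the directions `K ≤ ℂ^{n×n}` of a whole-pencil ledger `(K, k)` (window `k + 2 ≤ n`)
have linear parts `lin v` of nil-index `≤ k + 1`.  This file pushes the shadow forward along the (linear) map `v ↦ lin v` into the VALUE SPACE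
`L₀ := span {lin v} ⊆ M_b(ℂ)` (a linear space of nilpotent matrices — the top homogeneous part of the pencil), where it no longer mentions coordinates:

* `exists_linearMap_linMat` — `v ↦ linMat N v` is (the coercion of) a linear map (stated as an existence, no definition).
* ★ `codim_map_le_codim` — for a linear map `T` on `ℂ^{n×n}` and every direction space `K`: `dim (range T) − dim (T K) ≤ n² − dim K`
  (rank–nullity twice: the shadow is no more expensive than the certificate).
* ★ `exists_boundedIndex_subspace_of_relCert` — **INTRINSIC INDEX SHADOW.**  A certificate of price `P` of an affine pencil `N` (`N^m = 0`) yields an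
  order `k` and a linear subspace `W ≤ L₀ = span {lin v}` with `n·k + (dim L₀ − dim W) ≤ P` and, when `k + 2 ≤ n`, `X^{k+1} = 0` for every `X ∈ W`.
* `boundedIndexLaw_of_longMassSlowLawInv` — by name: (c) ⟹ for every `IrreducibleInv` nilpotent affine `b × b` pencil (large `n`), its space of linear
  parts `L₀ ⊆ M_b(ℂ)` contains a subspace `W` of nil-index `≤ k + 1` with `n·k + codim_{L₀} W ≤ c·√n·b` (when `k + 2 ≤ n`).  So a (c)-violator can be
  certified by a statement about ONE nilpotent matrix space: «every subspace of `L₀` of nil-index `≤ k+1` has codimension `> c√n·b − n·k`, for every `k`»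
  (a Gerstenhaber-type question on bounded-index subspaces INSIDE a nilpotent space; a one-dimensional witness never suffices by the dimension count
  recorded in the module docstring of ✓ `…LongMassLedgerIndexShadow`).

HONEST FRAMING.  Instrument / necessary condition (`--supports stmt-ValiantsHypothesis-24318`); NOT progress on (c) (RESEARCH — OPEN); closes no stub;
24318, 8062, `VP ≠ VNP` NOT proved.  No definitions, no named facts, no sorry.  [folklore: rank–nullity]
-/

set_option linter.dupNamespace false
set_option autoImplicit false

namespace Summit.ValiantsHypothesis.ValiantsHypothesis.Theorems.GrenetZeon.LedgerIndex

open MvPolynomial Matrix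
open scoped BigOperators Polynomial
open Summit.ValiantsHypothesis.ValiantsHypothesis.Cruxes.TwoDimCoefficients.DimTwoCases (AffMat IsAffine)
open Summit.ValiantsHypothesis.ValiantsHypothesis.Theorems.GrenetZeon.SlowCore
  (linEntry Ledger RelCert IrreducibleInv LongMassSlowLawInv linFun linFun_apply)
open Summit.ValiantsHypothesis.ValiantsHypothesis.Theorems.GrenetZeon.ResolventFlag (linMat)

variable {n m : ℕ}

/-! ## §1 The linear-part map and rank–nullity -/

/-- `v ↦ lin v` is a linear map `ℂ^{n×n} →ₗ M_m(ℂ)` (existence form; entries are the linear functionals ✓ `SlowCore.linFun`). [folklore] -/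
theorem exists_linearMap_linMat (N : AffMat n m) :
    ∃ T : (Fin n × Fin n → ℂ) →ₗ[ℂ] Matrix (Fin m) (Fin m) ℂ, ∀ v, T v = linMat N v := by
  refine ⟨{ toFun := fun v => linMat N v, map_add' := ?_, map_smul' := ?_ }, fun v => rfl⟩
  · intro u w
    ext i j
    simp only [linMat, Matrix.of_apply, Matrix.add_apply, ← linFun_apply, map_add]
  · intro r u
    ext i j
    simp only [linMat, Matrix.of_apply, Matrix.smul_apply, ← linFun_apply, map_smul, RingHom.id_apply]

/-- ★ **The shadow is no more expensive than the certificate.**  For a linear map `T` on the coordinates and every direction space `K`: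
`dim (range T) − dim (T K) ≤ n² − dim K`. [folklore: rank–nullity twice] -/
theorem codim_map_le_codim (T : (Fin n × Fin n → ℂ) →ₗ[ℂ] Matrix (Fin m) (Fin m) ℂ) (K : Submodule ℂ (Fin n × Fin n → ℂ)) :
    Module.finrank ℂ (LinearMap.range T) - Module.finrank ℂ (K.map T) ≤ n * n - Module.finrank ℂ K := by
  have h1 := LinearMap.finrank_range_add_finrank_ker T
  have h2 := LinearMap.finrank_range_add_finrank_ker (T ∘ₗ K.subtype)
  have hV : Module.finrank ℂ (Fin n × Fin n → ℂ) = n * n := by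
    rw [Module.finrank_pi, Fintype.card_prod, Fintype.card_fin]
  have hrange : LinearMap.range (T ∘ₗ K.subtype) = K.map T := by
    rw [LinearMap.range_comp, Submodule.range_subtype]
  have hker : Module.finrank ℂ (LinearMap.ker (T ∘ₗ K.subtype)) ≤ Module.finrank ℂ (LinearMap.ker T) := by
    -- `K.subtype` maps the restricted kernel injectively into `ker T`
    let f : LinearMap.ker (T ∘ₗ K.subtype) →ₗ[ℂ] LinearMap.ker T :=
      { toFun := fun w => ⟨(w.1 : Fin n × Fin n → ℂ), by
          have hw := w.2
          rw [LinearMap.mem_ker, LinearMap.comp_apply] at hw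
          rw [LinearMap.mem_ker]; exact hw⟩
        map_add' := fun _ _ => rfl
        map_smul' := fun _ _ => rfl }
    have hf : Function.Injective f := by
      intro a b hab
      have h := congrArg (fun z : LinearMap.ker T => (z : Fin n × Fin n → ℂ)) hab
      exact Subtype.ext (Subtype.ext h)
    exact LinearMap.finrank_le_finrank_of_injective hf
  rw [hrange] at h2
  have hK : Module.finrank ℂ K ≤ n * n := by
    calc Module.finrank ℂ K ≤ Module.finrank ℂ (Fin n × Fin n → ℂ) := Submodule.finrank_le K
      _ = n * n := hV
  omega

/-! ## §2 The intrinsic index shadow -/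

/-- ★ **INTRINSIC INDEX SHADOW.**  A certificate of price `P` yields an order `k` and a subspace `W` of the value space `L₀ = span {lin v}` with
`n·k + codim_{L₀} W ≤ P`, all of whose members satisfy `X^{k+1} = 0` when the window sees that power (`k + 2 ≤ n`). -/
theorem exists_boundedIndex_subspace_of_relCert (N : AffMat n m) (hN : IsAffine N) (hnil : N ^ m = 0) {P : ℕ}
    (h : RelCert n m N P) :
    ∃ (k : ℕ) (W : Submodule ℂ (Matrix (Fin m) (Fin m) ℂ)), W ≤ Submodule.span ℂ (Set.range (linMat N)) ∧
      n * k + (Module.finrank ℂ (Submodule.span ℂ (Set.range (linMat N))) - Module.finrank ℂ W) ≤ P ∧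
      (k + 2 ≤ n → ∀ X ∈ W, X ^ (k + 1) = 0) := by
  obtain ⟨K, k, hc, hsh⟩ := exists_indexShadow_of_relCert N hN hnil h
  obtain ⟨T, hT⟩ := exists_linearMap_linMat N
  have hspan : Submodule.span ℂ (Set.range (linMat N)) = LinearMap.range T := by
    have hfun : linMat N = ⇑T := funext fun v => (hT v).symm
    rw [hfun, ← LinearMap.coe_range, Submodule.span_eq]
  refine ⟨k, K.map T, ?_, ?_, ?_⟩
  · rw [hspan]; exact LinearMap.map_le_range
  · rw [hspan]
    have := codim_map_le_codim T K
    omega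
  · intro hk X hX
    obtain ⟨v, hv, rfl⟩ := Submodule.mem_map.1 hX
    rw [hT]
    exact hsh hk v hv

/-- The **BOUNDED-INDEX LAW** implied by (c), intrinsic form (by name): (c) ⟹ for every `IrreducibleInv` nilpotent affine `b × b` pencil `B` over the
`n²` coordinates (`n ≥ n₀`), the value space `L₀ = span {lin v}` of its linear part contains a subspace `W` of nil-index `≤ k + 1` (when `k + 2 ≤ n`)
with `n·k + codim_{L₀} W ≤ c·√n·b`. -/
theorem boundedIndexLaw_of_longMassSlowLawInv (h : LongMassSlowLawInv) :
    ∃ c n₀ : ℕ, ∀ n ≥ n₀, ∀ b : ℕ, ∀ B : AffMat n b, IsAffine B → B ^ b = 0 → IrreducibleInv B →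
      ∃ (k : ℕ) (W : Submodule ℂ (Matrix (Fin b) (Fin b) ℂ)), W ≤ Submodule.span ℂ (Set.range (linMat B)) ∧
        n * k + (Module.finrank ℂ (Submodule.span ℂ (Set.range (linMat B))) - Module.finrank ℂ W) ≤ c * (Nat.sqrt n * b) ∧
        (k + 2 ≤ n → ∀ X ∈ W, X ^ (k + 1) = 0) := by
  obtain ⟨c, n₀, hc⟩ := h
  exact ⟨c, n₀, fun n hn b B hB hnil hirr => exists_boundedIndex_subspace_of_relCert B hB hnil (hc n hn b B hB hnil hirr)⟩

end Summit.ValiantsHypothesis.ValiantsHypothesis.Theorems.GrenetZeon.LedgerIndex
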